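import Literature.Algebra.Lie.GoursatSimpleFactor
import Literature.Algebra.Lie.SemisimpleDimensionSix
import HarnessLib

/-!
# A semisimple Lie algebra of dimension `10` over a field of characteristic `0` is simple

Topic `Literature/Algebra/Lie`.  Theorems only (no definition, no named fact), Mathlib vocabulary (`LieAlgebra.IsSemisimple`,
`LieAlgebra.IsSimple`, the Boolean algebra of ideals).  Sequel of `SemisimpleDimensionSix` / `SemisimpleDimensionEight` (cell
`pub-hodgecm2`, seat `b27`, count-neutral Mumford–Tate-rank ladder): every ideal of a semisimple Lie algebra has trivial radical, hence
dimension `∉ {1, 2, 4, 5, 7}` (`GoursatSimpleFactor.finrank_lieIdeal_ne`); a proper atom `A` of a `10`-dimensional semisimple `L` and its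
complement `Aᶜ` would have dimensions `(3, 7)`, `(6, 4)`, `(8, 2)` or `(9, 1)` — all excluded.  Over an algebraically closed field the
algebra is `𝔰𝔭₄ ≅ 𝔰𝔬₅`; used for the Hodge Lie algebra `𝔰𝔭₄` of an abelian surface with `End⁰ = ℚ`.

* **`isSimple_of_finrank_eq_ten`** — `L` semisimple over a field of characteristic `0`, `dim L = 10` ⟹ `L` simple.

## References
* [Humphreys1972] J. E. Humphreys, *Introduction to Lie Algebras and Representation Theory*, GTM 9 (1972), §5.2, §8.4.
  [cite: Humphreys1972, §5.2]
-/

namespace Literature.Algebra.Lie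

namespace SemisimpleSmallDimension

open LieAlgebra Module

variable {K L : Type*} [Field K] [CharZero K] [LieRing L] [LieAlgebra K L] [FiniteDimensional K L]

omit [CharZero K] in
/-- Dimensions add up along a complementary pair of ideals. [folklore] -/
private theorem finrank_add_finrank_of_isCompl₁₀ {A B : LieIdeal K L} (hc : IsCompl A B) :
    finrank K A + finrank K B = finrank K L := by
  have hc' : IsCompl A.toSubmodule B.toSubmodule := LieSubmodule.isCompl_toSubmodule.2 hc
  have h1 := Submodule.finrank_sup_add_finrank_inf_eq A.toSubmodule B.toSubmodule
  rw [hc'.sup_eq_top, hc'.inf_eq_bot, finrank_top, finrank_bot, add_zero] at h1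
  exact h1.symm

/-- **A semisimple Lie algebra of dimension `10` over a field of characteristic `0` is simple** (over an algebraically closed field it
is `𝔰𝔭₄ ≅ 𝔰𝔬₅`).  A proper atom `A` is a non-zero ideal `≠ ⊤` with non-zero complement `Aᶜ`; both are ideals of a semisimple Lie
algebra, so `dim A, dim Aᶜ ∉ {0, 1, 2, 4, 5, 7}` with `dim A + dim Aᶜ = 10` — impossible.  Otherwise every atom is `⊤` and `L` is simple.
[cite: Humphreys1972, §5.2] [cite: Humphreys1972, §8.4] -/
theorem isSimple_of_finrank_eq_ten [LieAlgebra.IsSemisimple K L] (h10 : finrank K L = 10) : LieAlgebra.IsSimple K L := by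
  by_cases hex : ∃ A : LieIdeal K L, IsAtom A ∧ A ≠ ⊤
  · exfalso
    obtain ⟨A, hA, hne⟩ := hex
    have hc : IsCompl A Aᶜ := isCompl_compl
    have hsum := finrank_add_finrank_of_isCompl₁₀ (K := K) hc
    have hnA := GoursatSimpleFactor.finrank_lieIdeal_ne (K := K) A
    have hnAc := GoursatSimpleFactor.finrank_lieIdeal_ne (K := K) (Aᶜ : LieIdeal K L)
    have e1 : finrank K A.toSubmodule = finrank K A := rfl
    have e2 : finrank K (Aᶜ : LieIdeal K L).toSubmodule = finrank K (Aᶜ : LieIdeal K L) := rfl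
    -- `A ≠ ⊥`, `Aᶜ ≠ ⊥`
    have hA0 : finrank K A ≠ 0 := fun h0 => by
      apply hA.1
      have hsub : A.toSubmodule = (⊥ : LieIdeal K L).toSubmodule := by
        rw [LieSubmodule.bot_toSubmodule]
        exact Submodule.finrank_eq_zero.1 (by rw [e1, h0])
      exact (LieSubmodule.toSubmodule_inj A ⊥).1 hsub
    have hAc0 : finrank K (Aᶜ : LieIdeal K L) ≠ 0 := fun h0 => by
      apply hne
      have hbot : (Aᶜ : LieIdeal K L) = ⊥ := by
        have hsub : (Aᶜ : LieIdeal K L).toSubmodule = (⊥ : LieIdeal K L).toSubmodule := by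
          rw [LieSubmodule.bot_toSubmodule]
          exact Submodule.finrank_eq_zero.1 (by rw [e2, h0])
        exact (LieSubmodule.toSubmodule_inj _ ⊥).1 hsub
      have := hc.sup_eq_top
      rwa [hbot, sup_bot_eq] at this
    omega
  · push Not at hex
    exact isSimple_of_forall_isAtom_eq_top (by omega) hex

end SemisimpleSmallDimension

end Literature.Algebra.Lie
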